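import Summits.HubbardSuperconductivity.HubbardSuperconductivity.Theorems.DeformationLadderLadderThesisNormalForms

/-!
# Route `TwistGap`, support `TgStabilityEquivalence` (item `stmt-HubbardSuperconductivity-1513`)

For ALL real `U, δ` (notation: even `L`, `K_L = szSector N_L 0`, `N_L = 2⌊(1−δ)L²/2⌋`,
`H_L = hubbardTorus 2 L 1 U`, `E₀ = minEnergyOn H_L K_L`, `P = Δ_dᴴΔ_d`, `Δ_d = pairField d L`,
`LRO(φ) = L⁻⁴ Re⟨φ, P φ⟩`):

`S⁺(U,δ)` [`∃ λ, c > 0, L₀: ∀ even L ≥ L₀, ∀ unit φ ∈ K_L, c ≤ LRO(φ) + λ(Re⟨φ, H_L φ⟩ − E₀)`]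
`↔` [`∃ s₀, c' > 0, L₀: ∀ even L ≥ L₀, ∀ s ∈ [0, s₀]`, every sector ground state `φ` of the PENALISED
matrix `H_L + (s/L⁴)P` (`IsGroundStateInSector`, not normalised) has `c'‖φ‖² ≤ LRO(φ)`].

* (→) `tgStable_of_tgThesisAt`: normalise the ground state; minimality of the penalised energy
  against any unit vector of the sector gives `Re⟨φ, H_L φ⟩ ≤ E_s ≤ E₀ + 32 s` (the tree's
  `minEnergyOn_penalised_le`, `‖P‖ ≤ 32 L⁴`), so `S⁺` yields `LRO(φ) ≥ c − 32 λ s ≥ c/2` for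
  `s ≤ s₀ := c/(64λ)`; homogeneity (`expect_smul_self`) removes the normalisation.
* (←) `tgThesisAt_of_tgStable`: only the endpoint `s₀` is used. A unit vector `φ ∈ K_L` makes the
  sector a nonzero invariant coordinate subspace, so the penalised matrix has a normalised sector
  ground state `ψ` (`penalised_groundState_of_unit`, from the tree's `sector_groundState`); the
  hypothesis gives `LRO(ψ) ≥ c'`, hence the penalty gap `E_{s₀} − E₀ ≥ c' s₀`
  (`penaltyGap_ge_of_groundState`), and the variational principle for `H_L + (s₀/L⁴)P` at `φ`
  gives `c' ≤ LRO(φ) + (1/s₀)(Re⟨φ, H_L φ⟩ − E₀)` — `S⁺` with `(λ, c) = (1/s₀, c')`.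

No case analysis on `(U, δ)` is needed: for sectors without unit vectors both sides are vacuous.

Sources: the item's own two-line argument (planner card `TwistGap`; refuter review 77f872db);
T. Kato, *Perturbation Theory for Linear Operators* (1966) II-§5.4 and H. Tasaki, *Physics and
Mathematics of Quantum Many-Body Systems* (2020) §2.1–2.2 for the variational principle. No
definition is introduced.
-/

set_option linter.dupNamespace false

noncomputable section

namespace Summit.HubbardSuperconductivity.HubbardSuperconductivity.Theorems.TwistGap

open Matrix Literature.MathematicalPhysics.QuantumLattice Literature.Probability.LatticeModels
open Summit.HubbardSuperconductivity.HubbardSuperconductivity.Theses.TwistGap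
open Summit.HubbardSuperconductivity.HubbardSuperconductivity.Theorems.DeformationLadder
  (preservesSectors_penalised isHermitian_penalised minEnergyOn_penalised_le
    re_expect_pairPenalty_nonneg penaltyGap_ge_of_groundState)
open scoped ComplexOrder

/-! ### Homogeneity and normalisation -/

section Scaling

variable {ι : Type*} [Fintype ι]

/-- `⟨b v, b v⟩ = |b|² ⟨v, v⟩`. [folklore] -/
theorem star_smul_dotProduct_smul (b : ℂ) (v : ι → ℂ) :
    star (b • v) ⬝ᵥ (b • v) = ((Complex.normSq b : ℝ) : ℂ) * (star v ⬝ᵥ v) := by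
  rw [star_smul, smul_dotProduct, dotProduct_smul, smul_smul, smul_eq_mul, Complex.star_def,
    Complex.normSq_eq_conj_mul_self]

/-- `⟨b v, M (b v)⟩ = |b|² ⟨v, M v⟩`. [folklore] -/
theorem expect_smul_self [DecidableEq ι] (M : Matrix (Finset ι) (Finset ι) ℂ) (b : ℂ)
    (v : Fock ι) : expect M (b • v) = ((Complex.normSq b : ℝ) : ℂ) * expect M v := by
  unfold expect
  rw [mulVec_smul, star_smul, smul_dotProduct, dotProduct_smul, smul_smul, smul_eq_mul,
    Complex.star_def, Complex.normSq_eq_conj_mul_self]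

end Scaling

section Sector

variable (L : ℕ) [NeZero L]

/-- **A nonzero sector has penalised ground states.** If the joint sector `(N, S^z) = (2n, 0)`
contains a unit vector, then for every real `c` the penalised matrix `H_L + c·Δ_dᴴΔ_d` has a
NORMALISED ground state in that sector (`IsGroundStateInSector`): the sector is the coordinate
subspace of configurations with `n` up and `n` down electrons (`mem_szSector_two_mul_zero_iff`),
it is invariant (`preservesSectors_penalised`) and nonzero, so the tree's `sector_groundState`
applies; normalise with `exists_smul_unit`. Lieb, PRL 62 (1989) 1201, proof of Thm 1;
Tasaki (2020) §2.2. [folklore] -/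
theorem penalised_groundState_of_unit (U c : ℝ) (n : ℕ) {φ : Fock (Orb (FermionTorus 2 L))}
    (hφK : φ ∈ szSector (Λ := FermionTorus 2 L) (2 * n) 0) (hφ1 : star φ ⬝ᵥ φ = 1) :
    ∃ ψ, IsGroundStateInSector (hubbardTorus 2 L 1 U +
        ((c : ℝ) : ℂ) • ((pairField dWaveFormFactor L)ᴴ * pairField dWaveFormFactor L)) (2 * n) 0 ψ ∧
      star ψ ⬝ᵥ ψ = 1 := by
  classical
  set A := hubbardTorus 2 L 1 U +
    ((c : ℝ) : ℂ) • ((pairField dWaveFormFactor L)ᴴ * pairField dWaveFormFactor L) with hA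
  have hK : ∀ v : Fock (Orb (FermionTorus 2 L)), v ∈ szSector (2 * n) (0 : ℝ) ↔
      ∀ s, ¬((upPart s).card = n ∧ (downPart s).card = n) → v s = 0 :=
    fun v => mem_szSector_two_mul_zero_iff n v
  have hφ0 : φ ≠ 0 := by
    rintro rfl
    simp at hφ1
  have hp : ∃ s : Finset (Orb (FermionTorus 2 L)), (upPart s).card = n ∧ (downPart s).card = n := by
    by_contra h
    exact hφ0 (funext fun s => (hK φ).1 hφK s fun hs => h ⟨s, hs⟩)
  have hPS := preservesSectors_penalised L U ((c : ℝ) : ℂ)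
  have hinv : ∀ s s' : Finset (Orb (FermionTorus 2 L)),
      ¬((upPart s).card = n ∧ (downPart s).card = n) →
      ((upPart s').card = n ∧ (downPart s').card = n) → A s s' = 0 := by
    intro s s' hs hs'
    by_contra h
    have := hPS s s' h
    exact hs ⟨this.1.trans hs'.1, this.2.trans hs'.2⟩
  obtain ⟨⟨v, hv, hv0, hAv⟩, -⟩ := sector_groundState A (isHermitian_penalised L U c)
    (fun s => (upPart s).card = n ∧ (downPart s).card = n) hp hinv (szSector (2 * n) 0) hK
  obtain ⟨a, ha0, ha1⟩ := exists_smul_unit hv0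
  refine ⟨a • v, ⟨Submodule.smul_mem _ _ hv, smul_ne_zero ha0 hv0, ?_⟩, ha1⟩
  rw [mulVec_smul, hAv, smul_comm]

/-- **Energy of a normalised penalised ground state.** For a unit sector ground state `φ` of
`H_L + (s/L⁴)Δ_dᴴΔ_d` with `s ≥ 0`: `Re⟨φ, H_L φ⟩ ≤ E₀ + 32 s` (drop the nonnegative penalty from
`E_s = Re⟨φ, H_L φ⟩ + (s/L⁴)Re⟨φ, Δ_dᴴΔ_d φ⟩` and use `E_s ≤ E₀ + 32 s`).
Kaplan–Horsch–von der Linden, J. Phys. Soc. Jpn. 58 (1989) 3894. [cite: KaplanHorschVonDerLinden1989] -/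
theorem re_energy_le_of_penalised_groundState (U : ℝ) {s : ℝ} (hs : 0 ≤ s) (N : ℕ)
    {φ : Fock (Orb (FermionTorus 2 L))} (hφ1 : star φ ⬝ᵥ φ = 1)
    (hφ : IsGroundStateInSector (hubbardTorus 2 L 1 U + ((s / (L : ℝ) ^ 4 : ℝ) : ℂ) •
      ((pairField dWaveFormFactor L)ᴴ * pairField dWaveFormFactor L)) N 0 φ) :
    (star φ ⬝ᵥ hubbardTorus 2 L 1 U *ᵥ φ).re ≤
      (hubbardTorus 2 L 1 U).minEnergyOn (szSector N 0) + 32 * s := by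
  obtain ⟨hmem, -, heig⟩ := hφ
  have hL4 : (0 : ℝ) < (L : ℝ) ^ 4 := by
    have : (0 : ℝ) < L := by exact_mod_cast Nat.pos_of_ne_zero (NeZero.ne L)
    positivity
  set P := (pairField dWaveFormFactor L)ᴴ * pairField dWaveFormFactor L with hP
  -- `Re⟨φ, (H + s'P) φ⟩ = E_s`
  have h1 : (star φ ⬝ᵥ (hubbardTorus 2 L 1 U + ((s / (L : ℝ) ^ 4 : ℝ) : ℂ) • P) *ᵥ φ).re =
      (hubbardTorus 2 L 1 U + ((s / (L : ℝ) ^ 4 : ℝ) : ℂ) • P).minEnergyOn (szSector N 0) := by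
    rw [heig, dotProduct_smul, hφ1, smul_eq_mul, mul_one, Complex.ofReal_re]
  rw [add_mulVec, dotProduct_add, Complex.add_re, smul_mulVec, dotProduct_smul,
    smul_eq_mul, Complex.re_ofReal_mul] at h1
  -- `E_s ≤ E₀ + 32 s`
  have h2 := minEnergyOn_penalised_le L U hs (szSector N 0) ⟨φ, hmem, hφ1⟩
  -- the penalty is nonnegative
  have h3 : 0 ≤ s / (L : ℝ) ^ 4 * (star φ ⬝ᵥ P *ᵥ φ).re :=
    mul_nonneg (div_nonneg hs hL4.le) (re_expect_pairPenalty_nonneg L φ)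
  linarith

end Sector

/-! ### The two directions -/

/-- **(→) `S⁺` makes penalised ground states ordered.** If `c ≤ LRO(φ) + λ(Re⟨φ, H_L φ⟩ − E₀)` on
unit sector vectors at every even `L ≥ L₀`, then for `0 ≤ s ≤ c/(64λ)` every sector ground state
`φ` of `H_L + (s/L⁴)Δ_dᴴΔ_d` has `(c/2)‖φ‖² ≤ LRO(φ)` (normalise, `Re⟨φ̂, H_L φ̂⟩ − E₀ ≤ 32 s`,
so `LRO(φ̂) ≥ c − 32λs ≥ c/2`). [cite: KaplanHorschVonDerLinden1989] -/
theorem tgStable_of_tgThesisAt (U δ : ℝ)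
    (h : ∃ lam : ℝ, 0 < lam ∧ ∃ c : ℝ, 0 < c ∧ ∃ L₀ : ℕ, ∀ (L : ℕ) [NeZero L], L₀ ≤ L → Even L →
      ∀ φ : Fock (Orb (FermionTorus 2 L)),
        φ ∈ (szSector (Λ := FermionTorus 2 L) (2 * ⌊(1 - δ) * (L : ℝ) ^ 2 / 2⌋₊) 0) →
        star φ ⬝ᵥ φ = 1 →
          c ≤ (expect ((pairField dWaveFormFactor L)ᴴ * pairField dWaveFormFactor L) φ).re /
              (L : ℝ) ^ 4 +
            lam * ((expect (hubbardTorus 2 L 1 U) φ).re -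
              (hubbardTorus 2 L 1 U).minEnergyOn
                (szSector (2 * ⌊(1 - δ) * (L : ℝ) ^ 2 / 2⌋₊) 0))) :
    ∃ s₀ : ℝ, 0 < s₀ ∧ ∃ c' : ℝ, 0 < c' ∧ ∃ L₀ : ℕ, ∀ (L : ℕ) [NeZero L], L₀ ≤ L → Even L →
      ∀ s ∈ Set.Icc (0:ℝ) s₀, ∀ φ : Fock (Orb (FermionTorus 2 L)),
        IsGroundStateInSector (hubbardTorus 2 L 1 U + ((s / (L : ℝ) ^ 4 : ℝ) : ℂ) •
          ((pairField dWaveFormFactor L)ᴴ * pairField dWaveFormFactor L))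
          (2 * ⌊(1 - δ) * (L : ℝ) ^ 2 / 2⌋₊) 0 φ →
        c' * (star φ ⬝ᵥ φ).re ≤
          (expect ((pairField dWaveFormFactor L)ᴴ * pairField dWaveFormFactor L) φ).re /
            (L : ℝ) ^ 4 := by
  obtain ⟨lam, hlam, c, hc, L₀, h⟩ := h
  refine ⟨c / (64 * lam), by positivity, c / 2, by positivity, L₀, fun L _ hL hev s hs φ hφ => ?_⟩
  obtain ⟨hs0, hs1⟩ := hs
  have hL4 : (0 : ℝ) < (L : ℝ) ^ 4 := by
    have : (0 : ℝ) < L := by exact_mod_cast Nat.pos_of_ne_zero (NeZero.ne L)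
    positivity
  set P := (pairField dWaveFormFactor L)ᴴ * pairField dWaveFormFactor L with hP
  set N := 2 * ⌊(1 - δ) * (L : ℝ) ^ 2 / 2⌋₊ with hN
  obtain ⟨hmem, hne, heig⟩ := hφ
  -- normalise the ground state
  obtain ⟨a, ha0, ha1⟩ := exists_smul_unit hne
  have hmem' : a • φ ∈ szSector (Λ := FermionTorus 2 L) N 0 := Submodule.smul_mem _ _ hmem
  have hgs' : IsGroundStateInSector (hubbardTorus 2 L 1 U + ((s / (L : ℝ) ^ 4 : ℝ) : ℂ) • P)
      N 0 (a • φ) :=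
    ⟨hmem', smul_ne_zero ha0 hne, by rw [mulVec_smul, heig, smul_comm]⟩
  -- energy of the normalised ground state and `S⁺` at it
  have hE := re_energy_le_of_penalised_groundState L U hs0 N ha1 hgs'
  have hS := h L hL hev (a • φ) hmem' ha1
  unfold expect at hS hE ⊢
  have h32 : lam * ((star (a • φ) ⬝ᵥ hubbardTorus 2 L 1 U *ᵥ (a • φ)).re -
      (hubbardTorus 2 L 1 U).minEnergyOn (szSector N 0)) ≤ c / 2 := by
    calc lam * ((star (a • φ) ⬝ᵥ hubbardTorus 2 L 1 U *ᵥ (a • φ)).re -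
          (hubbardTorus 2 L 1 U).minEnergyOn (szSector N 0))
        ≤ lam * (32 * s) := mul_le_mul_of_nonneg_left (by linarith) hlam.le
      _ ≤ lam * (32 * (c / (64 * lam))) := by gcongr
      _ = c / 2 := by field_simp; ring
  have hlro : c / 2 ≤ (star (a • φ) ⬝ᵥ P *ᵥ (a • φ)).re / (L : ℝ) ^ 4 := by linarith
  -- undo the normalisation: both sides scale with `|a|²`
  have hsc : star (a • φ) ⬝ᵥ P *ᵥ (a • φ) = ((Complex.normSq a : ℝ) : ℂ) * (star φ ⬝ᵥ P *ᵥ φ) :=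
    expect_smul_self P a φ
  have hn1 : ((Complex.normSq a : ℝ) : ℂ) * (star φ ⬝ᵥ φ) = 1 := by
    rw [← star_smul_dotProduct_smul, ha1]
  have hn1' : Complex.normSq a * (star φ ⬝ᵥ φ).re = 1 := by
    have := congrArg Complex.re hn1
    rwa [Complex.re_ofReal_mul, Complex.one_re] at this
  have hpos : 0 < Complex.normSq a := Complex.normSq_pos.2 ha0
  rw [hsc, Complex.re_ofReal_mul] at hlro
  -- `(star φ ⬝ᵥ φ).re = 1/|a|²`
  have hφφ : (star φ ⬝ᵥ φ).re = (Complex.normSq a)⁻¹ := by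
    field_simp
    linarith
  rw [hφφ, le_div_iff₀ hL4]
  rw [le_div_iff₀ hL4] at hlro
  have := mul_le_mul_of_nonneg_left hlro (inv_nonneg.2 hpos.le)
  calc c / 2 * (Complex.normSq a)⁻¹ * (L : ℝ) ^ 4 = (Complex.normSq a)⁻¹ * (c / 2 * (L : ℝ) ^ 4) := by
        ring
    _ ≤ (Complex.normSq a)⁻¹ * (Complex.normSq a * (star φ ⬝ᵥ P *ᵥ φ).re) := this
    _ = (star φ ⬝ᵥ P *ᵥ φ).re := by rw [← mul_assoc, inv_mul_cancel₀ hpos.ne', one_mul]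

/-- **(←) Ordered penalised ground states give `S⁺`.** If at every even `L ≥ L₀` the sector ground
states of `H_L + (s₀/L⁴)Δ_dᴴΔ_d` have `c'‖φ‖² ≤ LRO(φ)`, then `c' ≤ LRO(φ) + (1/s₀)(Re⟨φ, H_L φ⟩ − E₀)`
for every unit sector vector `φ`: a normalised penalised ground state exists
(`penalised_groundState_of_unit`), it gives the gap `E_{s₀} − E₀ ≥ c' s₀`
(`penaltyGap_ge_of_groundState`), and `E_{s₀} ≤ Re⟨φ, H_L φ⟩ + s₀·LRO(φ)` (variational principle).
Kato (1966) II-§5.4; Tasaki (2020) §2.1. [cite: KaplanHorschVonDerLinden1989] -/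
theorem tgThesisAt_of_tgStable (U δ : ℝ)
    (h : ∃ s₀ : ℝ, 0 < s₀ ∧ ∃ c' : ℝ, 0 < c' ∧ ∃ L₀ : ℕ, ∀ (L : ℕ) [NeZero L], L₀ ≤ L → Even L →
      ∀ s ∈ Set.Icc (0:ℝ) s₀, ∀ φ : Fock (Orb (FermionTorus 2 L)),
        IsGroundStateInSector (hubbardTorus 2 L 1 U + ((s / (L : ℝ) ^ 4 : ℝ) : ℂ) •
          ((pairField dWaveFormFactor L)ᴴ * pairField dWaveFormFactor L))
          (2 * ⌊(1 - δ) * (L : ℝ) ^ 2 / 2⌋₊) 0 φ →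
        c' * (star φ ⬝ᵥ φ).re ≤
          (expect ((pairField dWaveFormFactor L)ᴴ * pairField dWaveFormFactor L) φ).re /
            (L : ℝ) ^ 4) :
    ∃ lam : ℝ, 0 < lam ∧ ∃ c : ℝ, 0 < c ∧ ∃ L₀ : ℕ, ∀ (L : ℕ) [NeZero L], L₀ ≤ L → Even L →
      ∀ φ : Fock (Orb (FermionTorus 2 L)),
        φ ∈ (szSector (Λ := FermionTorus 2 L) (2 * ⌊(1 - δ) * (L : ℝ) ^ 2 / 2⌋₊) 0) →
        star φ ⬝ᵥ φ = 1 →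
          c ≤ (expect ((pairField dWaveFormFactor L)ᴴ * pairField dWaveFormFactor L) φ).re /
              (L : ℝ) ^ 4 +
            lam * ((expect (hubbardTorus 2 L 1 U) φ).re -
              (hubbardTorus 2 L 1 U).minEnergyOn
                (szSector (2 * ⌊(1 - δ) * (L : ℝ) ^ 2 / 2⌋₊) 0)) := by
  obtain ⟨s₀, hs₀, c', hc', L₀, h⟩ := h
  refine ⟨1 / s₀, by positivity, c', hc', L₀, fun L _ hL hev φ hmem hφ1 => ?_⟩
  have hL4 : (0 : ℝ) < (L : ℝ) ^ 4 := by
    have : (0 : ℝ) < L := by exact_mod_cast Nat.pos_of_ne_zero (NeZero.ne L)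
    positivity
  set P := (pairField dWaveFormFactor L)ᴴ * pairField dWaveFormFactor L with hP
  -- a normalised ground state of the penalised matrix at `s₀` exists in the (nonzero) sector
  obtain ⟨ψ, hψ, hψ1⟩ :=
    penalised_groundState_of_unit L U (s₀ / (L : ℝ) ^ 4) (⌊(1 - δ) * (L : ℝ) ^ 2 / 2⌋₊) hmem hφ1
  -- it is ordered, hence the penalty gap `c' s₀ ≤ E_{s₀} − E₀`
  have hlro : c' ≤ (expect P ψ).re / (L : ℝ) ^ 4 := by
    have := h L hL hev s₀ ⟨hs₀.le, le_rfl⟩ ψ hψ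
    rwa [hψ1, Complex.one_re, mul_one] at this
  have hgap := penaltyGap_ge_of_groundState L U hs₀.le _ hψ1 hψ hlro
  -- variational principle for the penalised matrix at `φ`
  have h1 := minEnergyOn_le_re_rayleigh
    (hubbardTorus 2 L 1 U + ((s₀ / (L : ℝ) ^ 4 : ℝ) : ℂ) • P)
    (szSector (2 * ⌊(1 - δ) * (L : ℝ) ^ 2 / 2⌋₊) 0) hmem hφ1
  rw [add_mulVec, dotProduct_add, Complex.add_re, smul_mulVec, dotProduct_smul,
    smul_eq_mul, Complex.re_ofReal_mul] at h1
  have h2 : c' * s₀ ≤ s₀ / (L : ℝ) ^ 4 * (star φ ⬝ᵥ P *ᵥ φ).re +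
      ((star φ ⬝ᵥ hubbardTorus 2 L 1 U *ᵥ φ).re -
        (hubbardTorus 2 L 1 U).minEnergyOn (szSector (2 * ⌊(1 - δ) * (L : ℝ) ^ 2 / 2⌋₊) 0)) := by
    linarith
  unfold expect
  have h3 : c' = (c' * s₀) * (1 / s₀) := by field_simp
  have h4 : (s₀ / (L : ℝ) ^ 4 * (star φ ⬝ᵥ P *ᵥ φ).re +
      ((star φ ⬝ᵥ hubbardTorus 2 L 1 U *ᵥ φ).re -
        (hubbardTorus 2 L 1 U).minEnergyOn (szSector (2 * ⌊(1 - δ) * (L : ℝ) ^ 2 / 2⌋₊) 0))) *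
        (1 / s₀) =
      (star φ ⬝ᵥ P *ᵥ φ).re / (L : ℝ) ^ 4 +
        1 / s₀ * ((star φ ⬝ᵥ hubbardTorus 2 L 1 U *ᵥ φ).re -
          (hubbardTorus 2 L 1 U).minEnergyOn (szSector (2 * ⌊(1 - δ) * (L : ℝ) ^ 2 / 2⌋₊) 0)) := by
    field_simp
  rw [h3, ← h4]
  exact mul_le_mul_of_nonneg_right h2 (by positivity)

/-- **`TgStabilityEquivalence` holds** (route `TwistGap`, support item
`stmt-HubbardSuperconductivity-1513`): for all real `U, δ`, `S⁺(U,δ)` is equivalent to "`d`-wave LRO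
of the sector ground states survives the bounded penalty `(s/L⁴)Δ_dᴴΔ_d` designed to kill it, for
all `0 ≤ s ≤ s₀`". Constants: `(s₀, c') = (c/(64λ), c/2)` one way, `(λ, c) = (1/s₀, c')` the other.
Kato (1966) II-§5.4; Kaplan–Horsch–von der Linden (1989). [cite: KaplanHorschVonDerLinden1989] -/
theorem tgStabilityEquivalence_proof : TgStabilityEquivalence := fun U δ =>
  ⟨tgStable_of_tgThesisAt U δ, tgThesisAt_of_tgStable U δ⟩

end Summit.HubbardSuperconductivity.HubbardSuperconductivity.Theorems.TwistGap
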